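import Summits.Schanuel.Schanuel.Theorems.ZilberEacBranchChartClosedForm
import HarnessLib

/-!
# Arbitrary base branches, XXVIII: ALL phase coefficients down to the `τ`-carrying one —
# `Π_{M−j} = φ_j·c^{M−j}` (`j < k`) and `Π_{M−k} = c^{M−k}(φ_k + (M/k)·τ·φ_0)`

HONEST FRAMING.  Cell `pub-schanuel` (Zilber's Exponential-Algebraic Closedness, case ladder;
host summit Schanuel), seat 2, gen 29.  Files XIV and XXV computed the two top coefficients of the
phase polynomial `Π` of the witness (`r(m(s)) = Φ(s)s^{-M} − Π(1/m(s))`, `r` analytic) by iterated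
limits.  Here the computation is organised once and for all by a uniqueness principle for Taylor
polynomials, **`poly_eq_zero_of_tendsto_eval_div_pow`** (a polynomial of degree `≤ k` which is
`o(s^k)` at `0` vanishes).  With the chart in the form `m = c·s·G(s)`, `(G(s) − 1)/s^k → g`, and a
Taylor polynomial `P_Φ` of `Φ` to order `k` (`(Φ − P_Φ)/s^k → 0`), for `k < M`:
**`laurentPart_coeff_eq_of_taylor`** — `Π_{M−j} = c^{M−j}(P_Φ,j + [j = k]·M·g·P_Φ,0)` for every
`j ≤ k` (multiply the witness identity by `m(s)^M`: `c^M Φ G^M = Σ_j Π_{M−j} m^j + m^M r(m)`, and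
compare Taylor polynomials to order `k`; `G = 1 + g s^k + o(s^k)` enters only through `G^M`).
For the ramified chart of file XXIV (`G^k(1 − s^k(log(ψ/θ) + τ)) = 1`) one has `g = τ/k`
(**`chart_closed_form_tendsto`**), whence **`laurentPart_coeff_tau_eq`**:
`Π_{M−k} = m′(0)^{M−k}(φ_k + (M/k)·τ·φ_0)` — the first coefficient that carries the fibre value
`θ = e^τ` — and **`laurentPart_coeff_eq_of_lt`**: `Π_{M−j} = φ_j m′(0)^{M−j}` for `j < k`.
These decide, e.g., constant fibres over even-degree hyperelliptic bases (next files).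
Infrastructure; no density statement in this file.  EC(3,2) OPEN; NOT Schanuel's conjecture.
-/

noncomputable section

open Filter Topology Polynomial Complex

set_option linter.dupNamespace false

namespace Summit.Schanuel.Schanuel.Theorems

/-! ## Part A. Uniqueness of Taylor polynomials; elementary limits -/

/-- **A polynomial of degree `≤ k` which is `o(s^k)` at `0` is zero.** [folklore] -/
theorem poly_eq_zero_of_tendsto_eval_div_pow {k : ℕ} :
    ∀ {D : ℂ[X]}, D.natDegree ≤ k →
      Tendsto (fun s : ℂ => D.eval s / s ^ k) (𝓝[≠] (0 : ℂ)) (𝓝 0) → D = 0 := by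
  induction k with
  | zero =>
    intro D hdeg hlim
    obtain ⟨a, rfl⟩ := Polynomial.natDegree_eq_zero.1 (Nat.le_zero.1 hdeg)
    have hconst : Tendsto (fun _ : ℂ => a) (𝓝[≠] (0 : ℂ)) (𝓝 0) := by
      refine hlim.congr' ?_
      filter_upwards [self_mem_nhdsWithin] with s _
      rw [pow_zero, div_one, Polynomial.eval_C]
    rw [tendsto_nhds_unique tendsto_const_nhds hconst, map_zero]
  | succ k ih =>
    intro D hdeg hlim
    -- the constant coefficient vanishes: `D(s) = (D(s)/s^{k+1})·s^{k+1} → 0` and `D(s) → D(0)`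
    have hev : Tendsto (fun s : ℂ => D.eval s) (𝓝[≠] (0 : ℂ)) (𝓝 (D.coeff 0)) := by
      have h : Tendsto (fun s : ℂ => D.eval s) (𝓝 (0 : ℂ)) (𝓝 (D.eval 0)) :=
        D.continuousAt.tendsto
      rw [← Polynomial.coeff_zero_eq_eval_zero] at h
      exact h.mono_left nhdsWithin_le_nhds
    have hpow : Tendsto (fun s : ℂ => s ^ (k + 1)) (𝓝[≠] (0 : ℂ)) (𝓝 0) := by
      have h := (continuous_pow (k + 1)).tendsto (0 : ℂ)
      rw [zero_pow (Nat.succ_ne_zero k)] at h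
      exact h.mono_left nhdsWithin_le_nhds
    have hev' : Tendsto (fun s : ℂ => D.eval s / s ^ (k + 1) * s ^ (k + 1)) (𝓝[≠] (0 : ℂ))
        (𝓝 0) := by
      have h := hlim.mul hpow
      rwa [zero_mul] at h
    have h0 : D.coeff 0 = 0 := by
      refine tendsto_nhds_unique hev (hev'.congr' ?_)
      filter_upwards [self_mem_nhdsWithin] with s (hs : s ≠ 0)
      rw [div_mul_cancel₀ _ (pow_ne_zero _ hs)]
    -- `D = divX D · X`, and `divX D` satisfies the hypothesis for `k`
    have hD : D = D.divX * Polynomial.X := by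
      have h := Polynomial.divX_mul_X_add D
      rw [h0, map_zero, add_zero] at h
      exact h.symm
    have hdeg' : D.divX.natDegree ≤ k := by
      rw [Polynomial.natDegree_divX_eq_natDegree_tsub_one]
      omega
    have hlim' : Tendsto (fun s : ℂ => D.divX.eval s / s ^ k) (𝓝[≠] (0 : ℂ)) (𝓝 0) := by
      refine hlim.congr' ?_
      filter_upwards [self_mem_nhdsWithin] with s (hs : s ≠ 0)
      conv_lhs => rw [hD]
      rw [Polynomial.eval_mul, Polynomial.eval_X, pow_succ, mul_div_mul_right _ _ hs]
    rw [hD, ih hdeg' hlim', zero_mul]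

/-- `s^n → 0` along the punctured neighbourhood of `0` (`n ≥ 1`). [folklore] -/
theorem tendsto_pow_punctured {n : ℕ} (hn : 1 ≤ n) :
    Tendsto (fun s : ℂ => s ^ n) (𝓝[≠] (0 : ℂ)) (𝓝 0) := by
  have h := (continuous_pow n).tendsto (0 : ℂ)
  rw [zero_pow (by omega)] at h
  exact h.mono_left nhdsWithin_le_nhds

/-- If `(G(s) − 1)/s^k → g` (`k ≥ 1`) then `G(s) → 1` along `s → 0`, `s ≠ 0`. [folklore] -/
theorem tendsto_one_of_tendsto_sub_one_div_pow {G : ℂ → ℂ} {k : ℕ} (hk : 1 ≤ k) {g : ℂ}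
    (hG : Tendsto (fun s => (G s - 1) / s ^ k) (𝓝[≠] (0 : ℂ)) (𝓝 g)) :
    Tendsto G (𝓝[≠] (0 : ℂ)) (𝓝 1) := by
  have h : Tendsto (fun s => (G s - 1) / s ^ k * s ^ k + 1) (𝓝[≠] (0 : ℂ)) (𝓝 (g * 0 + 1)) :=
    (hG.mul (tendsto_pow_punctured hk)).add_const 1
  rw [mul_zero, zero_add] at h
  refine h.congr' ?_
  filter_upwards [self_mem_nhdsWithin] with s (hs : s ≠ 0)
  rw [div_mul_cancel₀ _ (pow_ne_zero _ hs), sub_add_cancel]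

/-- If `(G(s) − 1)/s^k → g` (`k ≥ 1`) then `(G(s)^j − 1)/s^k → j·g` for every `j`. [folklore] -/
theorem tendsto_pow_sub_one_div_pow {G : ℂ → ℂ} {k : ℕ} (hk : 1 ≤ k) {g : ℂ}
    (hG : Tendsto (fun s => (G s - 1) / s ^ k) (𝓝[≠] (0 : ℂ)) (𝓝 g)) (j : ℕ) :
    Tendsto (fun s => (G s ^ j - 1) / s ^ k) (𝓝[≠] (0 : ℂ)) (𝓝 ((j : ℂ) * g)) := by
  have hG1 := tendsto_one_of_tendsto_sub_one_div_pow hk hG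
  induction j with
  | zero =>
    simp only [pow_zero, sub_self, zero_div, Nat.cast_zero, zero_mul]
    exact tendsto_const_nhds
  | succ j ih =>
    have h := (hG1.mul ih).add hG
    have hval : (1 : ℂ) * ((j : ℂ) * g) + g = ((j + 1 : ℕ) : ℂ) * g := by push_cast; ring
    rw [hval] at h
    refine h.congr' ?_
    filter_upwards [self_mem_nhdsWithin] with s (hs : s ≠ 0)
    have hsk : s ^ k ≠ 0 := pow_ne_zero _ hs
    rw [pow_succ]
    field_simp
    ring

/-! ## Part B. The `k`-th Taylor coefficient of the closed-form chart factor: `g = τ/k` -/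

/-- **`(G(s) − 1)/s^k → τ/k`** for the closed-form factor `G` of the ramified chart
(`G^k·(1 − s^k(log(ψ(s)/θ) + τ)) = 1` near `0`, `G(0) = 1`, `ψ(0) = θ ≠ 0`, `k ≥ 1`): i.e.
`G(s) = 1 + (τ/k)s^k + o(s^k)` (indeed `G^k − 1 = s^k(log(ψ/θ) + τ)/E` and
`G^k − 1 = (G − 1)(1 + G + ⋯ + G^{k−1})`). [folklore] -/
theorem chart_closed_form_tendsto {ψ : ℂ → ℂ} (hψ : AnalyticAt ℂ ψ 0) {θ : ℂ} (hθ0 : θ ≠ 0)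
    (hψ0 : ψ 0 = θ) {τ : ℂ} {k : ℕ} (hk : 1 ≤ k) {G : ℂ → ℂ} (hGan : AnalyticAt ℂ G 0)
    (hG0 : G 0 = 1)
    (hGk : ∀ᶠ s in 𝓝 (0 : ℂ), G s ^ k * (1 - s ^ k * (Complex.log (ψ s / θ) + τ)) = 1) :
    Tendsto (fun s => (G s - 1) / s ^ k) (𝓝[≠] (0 : ℂ)) (𝓝 (τ / k)) := by
  have hk0 : k ≠ 0 := by omega
  have hkC : (k : ℂ) ≠ 0 := Nat.cast_ne_zero.2 hk0
  -- `A = log(ψ/θ) + τ → τ`, `E = 1 − s^k A → 1`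
  set A : ℂ → ℂ := fun s => Complex.log (ψ s / θ) + τ with hA
  have hslit0 : ψ 0 / θ ∈ Complex.slitPlane := by
    rw [hψ0, div_self hθ0]; exact Complex.one_mem_slitPlane
  have hAan : AnalyticAt ℂ A 0 := ((hψ.div_const).clog hslit0).add analyticAt_const
  have hA0 : A 0 = τ := by simp [hA, hψ0, div_self hθ0]
  have hAt : Tendsto A (𝓝[≠] (0 : ℂ)) (𝓝 τ) := by
    have h := hAan.continuousAt.tendsto
    rw [hA0] at h
    exact h.mono_left nhdsWithin_le_nhds
  set E : ℂ → ℂ := fun s => 1 - s ^ k * A s with hE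
  have hEan : AnalyticAt ℂ E 0 := analyticAt_const.sub ((analyticAt_id.pow k).mul hAan)
  have hE0 : E 0 = 1 := by simp [hE, zero_pow hk0]
  have hEt : Tendsto E (𝓝[≠] (0 : ℂ)) (𝓝 1) := by
    have h := hEan.continuousAt.tendsto
    rw [hE0] at h
    exact h.mono_left nhdsWithin_le_nhds
  have hEne : ∀ᶠ s in 𝓝[≠] (0 : ℂ), E s ≠ 0 := hEt.eventually_ne one_ne_zero
  have hGt : Tendsto G (𝓝[≠] (0 : ℂ)) (𝓝 1) := by
    have h := hGan.continuousAt.tendsto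
    rw [hG0] at h
    exact h.mono_left nhdsWithin_le_nhds
  have hsum : Tendsto (fun s => ∑ i ∈ Finset.range k, G s ^ i) (𝓝[≠] (0 : ℂ)) (𝓝 (k : ℂ)) := by
    have h := tendsto_finsetSum (Finset.range k) (fun i _ => hGt.pow i)
    simp only [one_pow, Finset.sum_const, Finset.card_range, nsmul_eq_mul, mul_one] at h
    exact h
  have hsumne : ∀ᶠ s in 𝓝[≠] (0 : ℂ), ∑ i ∈ Finset.range k, G s ^ i ≠ 0 := hsum.eventually_ne hkC
  have hquot : Tendsto (fun s => A s / E s) (𝓝[≠] (0 : ℂ)) (𝓝 τ) := by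
    have h := hAt.div hEt one_ne_zero
    rwa [div_one] at h
  have hmain : Tendsto (fun s => A s / E s / ∑ i ∈ Finset.range k, G s ^ i) (𝓝[≠] (0 : ℂ))
      (𝓝 (τ / k)) := hquot.div hsum hkC
  refine hmain.congr' ?_
  filter_upwards [hEne, hsumne, nhdsWithin_le_nhds hGk, self_mem_nhdsWithin]
    with s hEs hsums hGks (hs : s ≠ 0)
  have hgeom : (∑ i ∈ Finset.range k, G s ^ i) * (G s - 1) = G s ^ k - 1 := geom_sum_mul (G s) k
  have hGk' : G s ^ k * E s = 1 := by simpa only [hE, hA] using hGks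
  have hsk : s ^ k ≠ 0 := pow_ne_zero _ hs
  rw [div_div, div_eq_div_iff (mul_ne_zero hEs hsums) hsk]
  calc A s * s ^ k = 1 - E s := by simp only [hE]; ring
    _ = (G s ^ k - 1) * E s := by rw [sub_mul, hGk', one_mul]
    _ = (∑ i ∈ Finset.range k, G s ^ i) * (G s - 1) * E s := by rw [hgeom]
    _ = (G s - 1) * (E s * ∑ i ∈ Finset.range k, G s ^ i) := by ring

/-! ## Part C. All phase coefficients down to order `M − k` -/

/-- **The phase coefficients from a Taylor polynomial.**  Let `m(s) = c·s·G(s)` near `0` with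
`c ≠ 0` and `(G(s) − 1)/s^k → g` (`k ≥ 1`); let `P_Φ` of degree `≤ k` be a Taylor polynomial of
`Φ` to order `k` (`(Φ(s) − P_Φ(s))/s^k → 0`); let `Π` of degree `≤ M` (`M > k`) and `r` continuous
at `0` satisfy `r(m(s)) = Φ(s)s^{-M} − Π(1/m(s))` for small `s ≠ 0`.  Then for every `j ≤ k`:
`Π_{M−j} = c^{M−j}(P_Φ,j + [j = k]·M·g·P_Φ,0)`. [folklore] -/
theorem laurentPart_coeff_eq_of_taylor {m : ℂ → ℂ} {c : ℂ} (hc0 : c ≠ 0) {G : ℂ → ℂ} {k : ℕ}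
    (hk : 1 ≤ k) {g : ℂ} (hGT : Tendsto (fun s => (G s - 1) / s ^ k) (𝓝[≠] (0 : ℂ)) (𝓝 g))
    (hmG : ∀ᶠ s in 𝓝 (0 : ℂ), m s = c * s * G s)
    {Φ : ℂ → ℂ} {PΦ : ℂ[X]} (hPΦ : PΦ.natDegree ≤ k)
    (hΦT : Tendsto (fun s => (Φ s - PΦ.eval s) / s ^ k) (𝓝[≠] (0 : ℂ)) (𝓝 0))
    {M : ℕ} (hkM : k < M) {Pl : ℂ[X]} (hdeg : Pl.natDegree ≤ M) {r : ℂ → ℂ}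
    (hr : ContinuousAt r 0)
    (hside : ∀ᶠ s in 𝓝[≠] (0 : ℂ), r (m s) = Φ s * (s ^ M)⁻¹ - Pl.eval (m s)⁻¹)
    {j : ℕ} (hj : j ≤ k) :
    Pl.coeff (M - j) =
      c ^ (M - j) * (PΦ.coeff j + if j = k then (M : ℂ) * g * PΦ.coeff 0 else 0) := by
  classical
  have hGi := tendsto_pow_sub_one_div_pow hk hGT
  have hG1 : Tendsto G (𝓝[≠] (0 : ℂ)) (𝓝 1) := tendsto_one_of_tendsto_sub_one_div_pow hk hGT
  have hGne : ∀ᶠ s in 𝓝[≠] (0 : ℂ), G s ≠ 0 := hG1.eventually_ne one_ne_zero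
  have hid : Tendsto (fun s : ℂ => s) (𝓝[≠] (0 : ℂ)) (𝓝 0) := tendsto_id.mono_left nhdsWithin_le_nhds
  have hm0t : Tendsto m (𝓝[≠] (0 : ℂ)) (𝓝 0) := by
    have h := ((tendsto_const_nhds (x := c)).mul hid).mul hG1
    rw [mul_zero, zero_mul] at h
    exact h.congr' (by filter_upwards [nhdsWithin_le_nhds hmG] with s hs; rw [hs])
  have hrm : Tendsto (fun s => r (m s)) (𝓝[≠] (0 : ℂ)) (𝓝 (r 0)) := hr.tendsto.comp hm0t
  have hPΦt : Tendsto (fun s => PΦ.eval s) (𝓝[≠] (0 : ℂ)) (𝓝 (PΦ.coeff 0)) := by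
    have h : Tendsto (fun s : ℂ => PΦ.eval s) (𝓝 (0 : ℂ)) (𝓝 (PΦ.eval 0)) :=
      PΦ.continuousAt.tendsto
    rw [← Polynomial.coeff_zero_eq_eval_zero] at h
    exact h.mono_left nhdsWithin_le_nhds
  have hpowi : ∀ i : ℕ, Tendsto (fun s : ℂ => s ^ i) (𝓝[≠] (0 : ℂ)) (𝓝 ((0 : ℂ) ^ i)) :=
    fun i => ((continuous_pow i).tendsto (0 : ℂ)).mono_left nhdsWithin_le_nhds
  -- (*) the witness identity multiplied by `m(s)^M`
  have hstar : ∀ᶠ s in 𝓝[≠] (0 : ℂ),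
      ∑ i ∈ Finset.range (M + 1), Pl.coeff (M - i) * (c * s * G s) ^ i =
        c ^ M * G s ^ M * Φ s - c ^ M * s ^ M * G s ^ M * r (m s) := by
    filter_upwards [hside, nhdsWithin_le_nhds hmG, hGne, self_mem_nhdsWithin]
      with s hs hmGs hGs (hs0 : s ≠ 0)
    have hms : m s ≠ 0 := by rw [hmGs]; exact mul_ne_zero (mul_ne_zero hc0 hs0) hGs
    have hrefl : m s ^ M * Pl.eval (m s)⁻¹ =
        ∑ i ∈ Finset.range (M + 1), Pl.coeff (M - i) * m s ^ i := by
      rw [Polynomial.eval_eq_sum_range' (Nat.lt_succ_of_le hdeg), Finset.mul_sum,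
        ← Finset.sum_range_reflect _ (M + 1)]
      refine Finset.sum_congr rfl fun i hi => ?_
      have hi' : i ≤ M := Nat.lt_succ_iff.1 (Finset.mem_range.1 hi)
      rw [show M + 1 - 1 - i = M - i from by omega, inv_pow]
      have hsplit : m s ^ M = m s ^ i * m s ^ (M - i) := by
        rw [← pow_add]; congr 1; omega
      rw [hsplit]
      field_simp
    have hPl : Pl.eval (m s)⁻¹ = Φ s * (s ^ M)⁻¹ - r (m s) := by rw [hs]; ring
    set ρ : ℂ := r (m s) with hρ
    have hsM : s ^ M ≠ 0 := pow_ne_zero _ hs0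
    calc ∑ i ∈ Finset.range (M + 1), Pl.coeff (M - i) * (c * s * G s) ^ i
        = ∑ i ∈ Finset.range (M + 1), Pl.coeff (M - i) * m s ^ i := by rw [hmGs]
      _ = m s ^ M * Pl.eval (m s)⁻¹ := hrefl.symm
      _ = m s ^ M * (Φ s * (s ^ M)⁻¹ - ρ) := by rw [hPl]
      _ = c ^ M * G s ^ M * Φ s - c ^ M * s ^ M * G s ^ M * ρ := by
          rw [hmGs]; field_simp; ring
  -- the candidate polynomial of degree `≤ k` that must vanish
  set D : ℂ[X] := Polynomial.C (c ^ M) * PΦ + Polynomial.C (c ^ M * M * g * PΦ.coeff 0) * X ^ k -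
      ∑ i ∈ Finset.range (k + 1), Polynomial.C (Pl.coeff (M - i) * c ^ i) * X ^ i with hD
  have hDdeg : D.natDegree ≤ k := by
    refine (Polynomial.natDegree_sub_le_of_le (Polynomial.natDegree_add_le_of_degree_le
      ((Polynomial.natDegree_C_mul_le _ _).trans hPΦ) (Polynomial.natDegree_C_mul_X_pow_le _ _))
      (Polynomial.natDegree_sum_le_of_forall_le _ _ fun i hi =>
        (Polynomial.natDegree_C_mul_X_pow_le _ _).trans
          (Nat.lt_succ_iff.1 (Finset.mem_range.1 hi)))).trans ?_
    rw [max_self]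
  have hDcoeff : ∀ i, i ≤ k → D.coeff i = c ^ M * PΦ.coeff i +
      (if i = k then c ^ M * M * g * PΦ.coeff 0 else 0) - Pl.coeff (M - i) * c ^ i := by
    intro i hi
    rw [hD, Polynomial.coeff_sub, Polynomial.coeff_add, Polynomial.coeff_C_mul,
      Polynomial.coeff_C_mul_X_pow, Polynomial.finsetSum_coeff]
    simp only [Polynomial.coeff_C_mul_X_pow]
    rw [Finset.sum_ite_eq, if_pos (Finset.mem_range.2 (by omega))]
  -- the limit `D(s)/s^k → 0`, assembled from six pieces
  have hT1 : Tendsto (fun s => c ^ M * G s ^ M * ((Φ s - PΦ.eval s) / s ^ k)) (𝓝[≠] (0 : ℂ))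
      (𝓝 (c ^ M * 1 ^ M * 0)) := (tendsto_const_nhds.mul (hG1.pow M)).mul hΦT
  have hT2 : Tendsto (fun s => c ^ M * PΦ.eval s * ((G s ^ M - 1) / s ^ k)) (𝓝[≠] (0 : ℂ))
      (𝓝 (c ^ M * PΦ.coeff 0 * ((M : ℂ) * g))) := (tendsto_const_nhds.mul hPΦt).mul (hGi M)
  have hT4 : Tendsto (fun s => c ^ M * s ^ (M - k) * G s ^ M * r (m s)) (𝓝[≠] (0 : ℂ))
      (𝓝 (c ^ M * 0 * 1 ^ M * r 0)) :=
    ((tendsto_const_nhds.mul (tendsto_pow_punctured (by omega))).mul (hG1.pow M)).mul hrm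
  have hT5 : Tendsto (fun s => ∑ i ∈ Finset.range (k + 1),
      Pl.coeff (M - i) * c ^ i * (s ^ i * ((G s ^ i - 1) / s ^ k))) (𝓝[≠] (0 : ℂ))
      (𝓝 (∑ i ∈ Finset.range (k + 1), Pl.coeff (M - i) * c ^ i * ((0 : ℂ) ^ i * ((i : ℂ) * g)))) :=
    tendsto_finsetSum _ fun i _ => tendsto_const_nhds.mul ((hpowi i).mul (hGi i))
  have hT6 : Tendsto (fun s => ∑ i ∈ Finset.Ico (k + 1) (M + 1),
      Pl.coeff (M - i) * c ^ i * (s ^ (i - k) * G s ^ i)) (𝓝[≠] (0 : ℂ))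
      (𝓝 (∑ i ∈ Finset.Ico (k + 1) (M + 1), Pl.coeff (M - i) * c ^ i * (0 * 1 ^ i))) :=
    tendsto_finsetSum _ fun i hi => tendsto_const_nhds.mul
      ((tendsto_pow_punctured (by rw [Finset.mem_Ico] at hi; omega)).mul (hG1.pow i))
  have hT := ((((hT1.neg.sub hT2).add (tendsto_const_nhds
    (x := c ^ M * M * g * PΦ.coeff 0))).add hT4).add hT5).add hT6
  have hval : -(c ^ M * 1 ^ M * 0) - c ^ M * PΦ.coeff 0 * ((M : ℂ) * g)
      + c ^ M * M * g * PΦ.coeff 0 + c ^ M * 0 * 1 ^ M * r 0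
      + ∑ i ∈ Finset.range (k + 1), Pl.coeff (M - i) * c ^ i * ((0 : ℂ) ^ i * ((i : ℂ) * g))
      + ∑ i ∈ Finset.Ico (k + 1) (M + 1), Pl.coeff (M - i) * c ^ i * (0 * 1 ^ i) = 0 := by
    rw [Finset.sum_eq_zero (s := Finset.range (k + 1)), Finset.sum_eq_zero (s := Finset.Ico _ _)]
    · ring
    · intro i _
      simp
    · intro i _
      rcases Nat.eq_zero_or_pos i with rfl | hi
      · simp
      · simp [zero_pow hi.ne']
  rw [hval] at hT
  have hDlim : Tendsto (fun s : ℂ => D.eval s / s ^ k) (𝓝[≠] (0 : ℂ)) (𝓝 0) := by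
    refine hT.congr' ?_
    filter_upwards [hstar, hGne, self_mem_nhdsWithin] with s hst hGs (hs0 : s ≠ 0)
    have hsk : s ^ k ≠ 0 := pow_ne_zero _ hs0
    -- (a) the low sum
    have ha : ∑ i ∈ Finset.range (k + 1), Pl.coeff (M - i) * c ^ i * (s ^ i * ((G s ^ i - 1) / s ^ k))
        = (∑ i ∈ Finset.range (k + 1), Pl.coeff (M - i) * (c * s * G s) ^ i -
            ∑ i ∈ Finset.range (k + 1), Pl.coeff (M - i) * c ^ i * s ^ i) / s ^ k := by
      rw [← Finset.sum_sub_distrib, Finset.sum_div]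
      refine Finset.sum_congr rfl fun i _ => ?_
      rw [mul_pow, mul_pow]
      field_simp
    -- (b) the high sum
    have hb : ∑ i ∈ Finset.Ico (k + 1) (M + 1), Pl.coeff (M - i) * c ^ i * (s ^ (i - k) * G s ^ i)
        = (∑ i ∈ Finset.Ico (k + 1) (M + 1), Pl.coeff (M - i) * (c * s * G s) ^ i) / s ^ k := by
      rw [Finset.sum_div]
      refine Finset.sum_congr rfl fun i hi => ?_
      have hik : k ≤ i := by rw [Finset.mem_Ico] at hi; omega
      rw [pow_sub₀ _ hs0 hik, mul_pow, mul_pow]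
      field_simp
    -- (c) the two sums together are `(*)`
    have hc : ∑ i ∈ Finset.Ico (k + 1) (M + 1), Pl.coeff (M - i) * (c * s * G s) ^ i =
        c ^ M * G s ^ M * Φ s - c ^ M * s ^ M * G s ^ M * r (m s) -
          ∑ i ∈ Finset.range (k + 1), Pl.coeff (M - i) * (c * s * G s) ^ i := by
      rw [← hst, ← Finset.sum_range_add_sum_Ico _ (by omega : k + 1 ≤ M + 1)]
      ring
    rw [ha, hb, hc, pow_sub₀ _ hs0 hkM.le, hD]
    simp only [Polynomial.eval_sub, Polynomial.eval_add, Polynomial.eval_mul, Polynomial.eval_C,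
      Polynomial.eval_pow, Polynomial.eval_X, Polynomial.eval_finsetSum]
    have hsM : s ^ M ≠ 0 := pow_ne_zero _ hs0
    field_simp
    ring
  -- conclusion: `D = 0`, read off the coefficient of `X^j`
  have hD0 : D = 0 := poly_eq_zero_of_tendsto_eval_div_pow hDdeg hDlim
  have hDj := hDcoeff j hj
  rw [hD0, Polynomial.coeff_zero] at hDj
  have hcM : c ^ (M - j) * c ^ j = c ^ M := by rw [← pow_add, Nat.sub_add_cancel (by omega)]
  apply mul_right_cancel₀ (pow_ne_zero j hc0)
  split_ifs at hDj ⊢ with hjk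
  · linear_combination hDj - (PΦ.coeff j + (M : ℂ) * g * PΦ.coeff 0) * hcM
  · linear_combination hDj - PΦ.coeff j * hcM

/-! ## Part D. The ramified chart: `Π_{M−j} = φ_j m′(0)^{M−j}` (`j < k`) and the `τ`-coefficient -/

/-- **The intermediate phase coefficients**: for the ramified chart `m`
(`2πi·m(s)^{-k} = s^{-k} − log(ψ(s)/θ) − τ`) and a Taylor polynomial `P_Φ` of `Φ` to order `k`,
`Π_{M−j} = P_Φ,j · m′(0)^{M−j}` for every `j < k` (`k < M`). [folklore] -/
theorem laurentPart_coeff_eq_of_lt {ψ : ℂ → ℂ} (hψ : AnalyticAt ℂ ψ 0) {θ : ℂ} (hθ0 : θ ≠ 0)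
    (hψ0 : ψ 0 = θ) {τ : ℂ} {k : ℕ} (hk : 1 ≤ k) {m : ℂ → ℂ} (hman : AnalyticAt ℂ m 0)
    (hm0 : m 0 = 0)
    (hchart : ∀ᶠ s in 𝓝 (0 : ℂ), AnalyticAt ℂ ψ s ∧ ψ s ≠ 0 ∧ ψ s / θ ∈ Complex.slitPlane ∧
        ‖Complex.log (ψ s / θ)‖ < 1 ∧
        (s ≠ 0 → m s ≠ 0 ∧
          (2 * Real.pi * I) * (m s ^ k)⁻¹ = (s ^ k)⁻¹ - Complex.log (ψ s / θ) - τ))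
    {Φ : ℂ → ℂ} {PΦ : ℂ[X]} (hPΦ : PΦ.natDegree ≤ k)
    (hΦT : Tendsto (fun s => (Φ s - PΦ.eval s) / s ^ k) (𝓝[≠] (0 : ℂ)) (𝓝 0))
    {M : ℕ} (hkM : k < M) {Pl : ℂ[X]} (hdeg : Pl.natDegree ≤ M) {r : ℂ → ℂ}
    (hr : AnalyticAt ℂ r 0)
    (hside : ∀ᶠ s in 𝓝[≠] (0 : ℂ), r (m s) = Φ s * (s ^ M)⁻¹ - Pl.eval (m s)⁻¹)
    {j : ℕ} (hj : j < k) :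
    Pl.coeff (M - j) = PΦ.coeff j * deriv m 0 ^ (M - j) := by
  have h2πI : (2 * Real.pi * I : ℂ) ≠ 0 := by simp [Real.pi_ne_zero, Complex.I_ne_zero]
  have hck : deriv m 0 ^ k = 2 * Real.pi * I := deriv_chart_pow_eq hψ hθ0 hψ0 hk hman hm0 hchart
  have hc0 : deriv m 0 ≠ 0 := by
    intro h0
    rw [h0, zero_pow (by omega)] at hck
    exact h2πI hck.symm
  obtain ⟨G, hGan, hG0, hGk, hmG⟩ := chart_closed_form hψ hθ0 hψ0 hk hman hm0 hchart
  have hGT := chart_closed_form_tendsto hψ hθ0 hψ0 hk hGan hG0 hGk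
  have h := laurentPart_coeff_eq_of_taylor hc0 hk hGT hmG hPΦ hΦT hkM hdeg hr.continuousAt hside
    hj.le
  rw [if_neg hj.ne, add_zero, mul_comm] at h
  exact h

/-- **The `τ`-carrying phase coefficient**: for the ramified chart `m`
(`2πi·m(s)^{-k} = s^{-k} − log(ψ(s)/θ) − τ`, `e^τ = θ = ψ(0)`) and a Taylor polynomial `P_Φ` of
`Φ` to order `k` (`k < M`): `Π_{M−k} = m′(0)^{M−k}·(P_Φ,k + (M/k)·τ·P_Φ,0)`. [folklore] -/
theorem laurentPart_coeff_tau_eq {ψ : ℂ → ℂ} (hψ : AnalyticAt ℂ ψ 0) {θ : ℂ} (hθ0 : θ ≠ 0)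
    (hψ0 : ψ 0 = θ) {τ : ℂ} {k : ℕ} (hk : 1 ≤ k) {m : ℂ → ℂ} (hman : AnalyticAt ℂ m 0)
    (hm0 : m 0 = 0)
    (hchart : ∀ᶠ s in 𝓝 (0 : ℂ), AnalyticAt ℂ ψ s ∧ ψ s ≠ 0 ∧ ψ s / θ ∈ Complex.slitPlane ∧
        ‖Complex.log (ψ s / θ)‖ < 1 ∧
        (s ≠ 0 → m s ≠ 0 ∧
          (2 * Real.pi * I) * (m s ^ k)⁻¹ = (s ^ k)⁻¹ - Complex.log (ψ s / θ) - τ))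
    {Φ : ℂ → ℂ} {PΦ : ℂ[X]} (hPΦ : PΦ.natDegree ≤ k)
    (hΦT : Tendsto (fun s => (Φ s - PΦ.eval s) / s ^ k) (𝓝[≠] (0 : ℂ)) (𝓝 0))
    {M : ℕ} (hkM : k < M) {Pl : ℂ[X]} (hdeg : Pl.natDegree ≤ M) {r : ℂ → ℂ}
    (hr : AnalyticAt ℂ r 0)
    (hside : ∀ᶠ s in 𝓝[≠] (0 : ℂ), r (m s) = Φ s * (s ^ M)⁻¹ - Pl.eval (m s)⁻¹) :
    Pl.coeff (M - k) = deriv m 0 ^ (M - k) * (PΦ.coeff k + (M : ℂ) / k * τ * PΦ.coeff 0) := by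
  have hkC : (k : ℂ) ≠ 0 := Nat.cast_ne_zero.2 (by omega)
  have h2πI : (2 * Real.pi * I : ℂ) ≠ 0 := by simp [Real.pi_ne_zero, Complex.I_ne_zero]
  have hck : deriv m 0 ^ k = 2 * Real.pi * I := deriv_chart_pow_eq hψ hθ0 hψ0 hk hman hm0 hchart
  have hc0 : deriv m 0 ≠ 0 := by
    intro h0
    rw [h0, zero_pow (by omega)] at hck
    exact h2πI hck.symm
  obtain ⟨G, hGan, hG0, hGk, hmG⟩ := chart_closed_form hψ hθ0 hψ0 hk hman hm0 hchart
  have hGT := chart_closed_form_tendsto hψ hθ0 hψ0 hk hGan hG0 hGk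
  have h := laurentPart_coeff_eq_of_taylor hc0 hk hGT hmG hPΦ hΦT hkM hdeg hr.continuousAt hside
    (le_refl k)
  rw [if_pos rfl] at h
  rw [h]
  field_simp

end Summit.Schanuel.Schanuel.Theorems

end
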